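import Literature.NumberTheory.EllipticCurves.FormalGroupLimitLogSeries
import Literature.RingTheory.FormalGroups.LogTypeSubstCongruence
import Literature.NumberTheory.EllipticCurves.PAdicHeightsProofs
import HarnessLib

/-!
# Values of a series of the SECOND KIND: if `G ∈ K⟦X⟧` has polynomially bounded coefficients and its `F_W`-coboundary
# `G(F_W(X,Y)) − G(X) − G(Y)` has coefficients of norm `≤ C`, then `‖G(s ⊕_W t) − G(s) − G(t)‖ ≤ C` on `𝔪_K`

Topic `Literature/NumberTheory/EllipticCurves`; namespace `Literature.NumberTheory.EllipticCurves`. THEOREMS ONLY (no definition, no named fact,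
no instance, no `sorry`). Setting: `K` a complete nontrivially normed ultrametric field, `W/ℤ` an integral Weierstrass equation with formal group
law `F_W` (values `evF W s t ∈ 𝔪_K`, tree `FormalGroupNilIdealPointsAdd`), `G = Σ cₙXⁿ ∈ K⟦X⟧` with `‖cₙ‖ ≤ n^k` (e.g. any LOG-TYPE series,
`‖n·cₙ‖ ≤ 1`, cf. `FormalGroupLogSeriesUltrametric.exists_nat_norm_inv_natCast_le_pow`), `G(x) := Σ' cₙ xⁿ` for `‖x‖ < 1`.

* §1 `tendsto_sum_range_coeff_mul_pow` (partial sums → `G(x)`), `norm_aeval_le_mul_pow_of_coeff` (a `K`-polynomial with coefficients `≤ B` supported in degrees `≥ N` has `‖q(y)‖ ≤ B·ρ^N` for `‖yᵢ‖ ≤ ρ ≤ 1`).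
* §2 Truncation algebra: `coe_truncTotal_eq_coe_trunc`, `coe_polynomial_aeval`, `map_truncTotal'`, ★ `truncTotal_subst_eq_truncTotal_coe_aeval`
  (`[G(a)]_{≤M} = [G_{≤M}(a_{≤M})]_{≤M}`, Mathlib `MvPowerSeries.truncTotal_subst`), `norm_coeff_aeval_trunc_le` (coefficients of `G_{≤M}(T)` are `≤ M^k`
  for an integral polynomial `T`).
* §3 ★★ `norm_tsum_evF_sub_tsum_sub_tsum_le` — **the value cocycle bound**: `‖G(F_W(s,t)) − G(s) − G(t)‖ ≤ C`. Proof: with `G_M = G_{≤M}`,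
  `T_M = (F_W)_{≤M}`, the polynomial `Q_M = G_M(T_M) − G_M(X) − G_M(Y)` agrees with the coboundary up to degree `M` (§2) and has coefficients `≤ M^k`,
  so `‖Q_M(s,t)‖ ≤ max(C, M^k ρ^{M+1})`; and `‖G_M(F_W(s,t)) − G_M(T_M(s,t))‖ ≤ M^k ρ^{M+1}` (`‖F_W(s,t) − T_M(s,t)‖ ≤ ρ^{M+1}`, tree
  `norm_coe_evF_sub_aeval_truncTotal_le`); let `M → ∞`. This is the analytic half of Katz's «functions of the second kind» / Colmez's period
  functional: bounded coboundary COEFFICIENTS give a uniformly bounded coboundary of VALUES on the open unit ball.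

Purpose (crux K★ `stmt-BirchSwinnertonDyer-22226`, line `kato_lever`, memo `Lines/kato-lever-K2-ramified-cm-transport.md` §9 (J1)): the Colmez functional
`𝒞_w(G) = lim pⁿG(wₙ)` along `[p]_{E₀}`-division towers for `G = log_{W_D}`, `log_{E₀}(Xᵖ)` (second kind for `F_{E₀}` by the transported Hodge line),
towards (HL-eval). Infrastructure only; BSD / K★ are not proved by any of this.

## References
* N. M. Katz, *Crystalline cohomology, Dieudonné modules, and Jacobi sums* (1981), §5.1 (functions of the second kind), Key Lemma 5.1.3. [Katz1981CrystallineDieudonne]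
* P. Colmez, *Périodes p-adiques des variétés abéliennes*, Math. Ann. 292 (1992), §2 (the period functional; not cited as a key).
* J. H. Silverman, *The Arithmetic of Elliptic Curves* (2009), IV.2, Thm. IV.6.4. [SilvermanAEC2009]
-/

noncomputable section

open scoped Classical Topology
open PowerSeries Filter Finset

namespace Literature.NumberTheory.EllipticCurves

open Literature.NumberTheory.GaloisRepresentations.LubinTate Literature.RingTheory.FormalGroups

variable {K : Type*} [NontriviallyNormedField K] [IsUltrametricDist K] [CompleteSpace K]

/-! ## §1 Analytic preliminaries -/

omit [IsUltrametricDist K] in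
/-- **Partial sums converge**: `Σ_{n<N} cₙxⁿ → Σ' cₙxⁿ` for `‖cₙ‖ ≤ n^k` and `‖x‖ < 1` (comparison with `Σ n^k rⁿ`). [cite: SilvermanAEC2009, IV.6.4] -/
theorem tendsto_sum_range_coeff_mul_pow (G : PowerSeries K) (k : ℕ) (hk : ∀ n, ‖PowerSeries.coeff n G‖ ≤ (n : ℝ) ^ k) {x : K} (hx : ‖x‖ < 1) :
    Tendsto (fun N : ℕ => ∑ n ∈ range N, PowerSeries.coeff n G * x ^ n) atTop (𝓝 (∑' n : ℕ, PowerSeries.coeff n G * x ^ n)) := by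
  have hg := summable_pow_mul_geometric_of_norm_lt_one k (show ‖(‖x‖ : ℝ)‖ < 1 by rwa [norm_norm])
  have hs : Summable fun n : ℕ => PowerSeries.coeff n G * x ^ n := by
    refine Summable.of_norm_bounded hg fun n => ?_
    rw [norm_mul, norm_pow]
    exact mul_le_mul_of_nonneg_right (hk n) (pow_nonneg (norm_nonneg x) n)
  exact hs.hasSum.tendsto_sum_nat

omit [CompleteSpace K] in
/-- **A `K`-polynomial with coefficients of norm `≤ B`, supported in total degrees `≥ N`, has `‖q(y)‖ ≤ B·ρ^N`** when `‖yᵢ‖ ≤ ρ ≤ 1`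
(ultrametric finite sum of monomials). [cite: SilvermanAEC2009, IV.2] -/
theorem norm_aeval_le_mul_pow_of_coeff {ι : Type*} {y : ι → K} {ρ : ℝ} (hρ0 : 0 ≤ ρ) (hρ1 : ρ ≤ 1) (hy : ∀ i, ‖y i‖ ≤ ρ)
    {q : MvPolynomial ι K} {B : ℝ} (hB0 : 0 ≤ B) (hB : ∀ d, ‖MvPolynomial.coeff d q‖ ≤ B) {N : ℕ}
    (hq : ∀ d : ι →₀ ℕ, d.degree < N → MvPolynomial.coeff d q = 0) :
    ‖MvPolynomial.aeval y q‖ ≤ B * ρ ^ N := by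
  rw [MvPolynomial.as_sum q, map_sum]
  refine IsUltrametricDist.norm_sum_le_of_forall_le_of_nonneg (by positivity) fun d hd => ?_
  have hN : N ≤ d.degree := not_lt.1 fun h => (MvPolynomial.mem_support_iff.1 hd) (hq d h)
  rw [MvPolynomial.aeval_monomial, norm_mul, Algebra.algebraMap_self_apply]
  refine mul_le_mul (hB d) ?_ (norm_nonneg _) hB0
  rw [Finsupp.prod, norm_prod]
  calc ∏ i ∈ d.support, ‖y i ^ d i‖ ≤ ∏ i ∈ d.support, ρ ^ d i :=
        Finset.prod_le_prod (fun i _ => norm_nonneg _) fun i _ => by rw [norm_pow]; exact pow_le_pow_left₀ (norm_nonneg _) (hy i) _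
    _ = ρ ^ d.degree := by rw [Finset.prod_pow_eq_pow_sum]; rfl
    _ ≤ ρ ^ N := pow_le_pow_of_le_one hρ0 hρ1 hN

/-! ## §2 Truncation algebra -/

section Algebra

variable {R : Type*} [CommRing R]

/-- The total-degree truncation of a ONE-variable series is its usual truncation: `↑(truncTotal k G) = ↑(trunc k G)` in `R⟦X⟧`.
[cite: Katz1981CrystallineDieudonne, §5.1] -/
theorem coe_truncTotal_eq_coe_trunc (G : PowerSeries R) (k : ℕ) :
    ((MvPowerSeries.truncTotal k G : MvPolynomial Unit R) : MvPowerSeries Unit R) = ((PowerSeries.trunc k G : Polynomial R) : PowerSeries R) := by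
  ext n
  rw [Polynomial.coeff_coe, PowerSeries.coeff_trunc, PowerSeries.coeff_def (s := Finsupp.single () n) (Finsupp.single_eq_same),
    MvPolynomial.coeff_coe, MvPowerSeries.coeff_truncTotal_eq_ite, Finsupp.degree_single]

/-- `↑(aeval T r) = aeval ↑T r` for a one-variable polynomial `r` and a multivariable polynomial `T` (the coercion to power series is a ring map).
[cite: Katz1981CrystallineDieudonne, §5.1] -/
theorem coe_polynomial_aeval {τ : Type*} (T : MvPolynomial τ R) (r : Polynomial R) :
    ((Polynomial.aeval T r : MvPolynomial τ R) : MvPowerSeries τ R) = Polynomial.aeval (T : MvPowerSeries τ R) r := by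
  rw [Polynomial.aeval_def, Polynomial.aeval_def, ← MvPolynomial.coeToMvPowerSeries.ringHom_apply, Polynomial.hom_eval₂,
    MvPolynomial.coeToMvPowerSeries.ringHom_apply]
  congr 1
  ext c
  rw [RingHom.comp_apply, MvPolynomial.coeToMvPowerSeries.ringHom_apply, MvPolynomial.algebraMap_eq, MvPolynomial.coe_C,
    MvPowerSeries.algebraMap_apply, Algebra.algebraMap_self_apply]

/-- Truncation commutes with a change of coefficients. [cite: Katz1981CrystallineDieudonne, §5.1] -/
theorem map_truncTotal' {S : Type*} [CommRing S] {τ : Type*} [Finite τ] (φ : R →+* S) (f : MvPowerSeries τ R) (k : ℕ) :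
    MvPowerSeries.truncTotal k (MvPowerSeries.map φ f) = MvPolynomial.map φ (MvPowerSeries.truncTotal k f) := by
  refine MvPolynomial.ext _ _ fun d => ?_
  rw [MvPolynomial.coeff_map, MvPowerSeries.coeff_truncTotal_eq_ite, MvPowerSeries.coeff_truncTotal_eq_ite, MvPowerSeries.coeff_map]
  split_ifs
  · rfl
  · rw [map_zero]

/-- ★ **`[G(a)]_{<k} = [G_{<k}(a_{<k})]_{<k}`**: the truncation below total degree `k` of a substituted one-variable series only sees the
truncations of the series and of the (constant-term-free) argument (Mathlib `MvPowerSeries.truncTotal_subst`, rewritten with honest polynomials).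
[cite: Katz1981CrystallineDieudonne, §5.1] -/
theorem truncTotal_subst_eq_truncTotal_coe_aeval {τ : Type*} [Finite τ] (G : PowerSeries R) (a : MvPowerSeries τ R)
    (ha : MvPowerSeries.constantCoeff a = 0) (k : ℕ) :
    MvPowerSeries.truncTotal k (G.subst a) =
      MvPowerSeries.truncTotal k ((Polynomial.aeval (MvPowerSeries.truncTotal k a) (PowerSeries.trunc k G) : MvPolynomial τ R) :
        MvPowerSeries τ R) := by
  have hb : PowerSeries.HasSubst ((MvPowerSeries.truncTotal k a : MvPolynomial τ R) : MvPowerSeries τ R) := by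
    refine PowerSeries.HasSubst.of_constantCoeff_zero ?_
    rw [← MvPowerSeries.coeff_zero_eq_constantCoeff_apply, MvPolynomial.coeff_coe, MvPowerSeries.coeff_truncTotal_eq_ite,
      MvPowerSeries.coeff_zero_eq_constantCoeff_apply, ha, ite_self]
  rw [show G.subst a = MvPowerSeries.subst (fun _ : Unit => a) G from rfl, MvPowerSeries.truncTotal_subst (fun _ => ha),
    coe_truncTotal_eq_coe_trunc, coe_polynomial_aeval,
    show MvPowerSeries.subst (fun _ : Unit => ((MvPowerSeries.truncTotal k a : MvPolynomial τ R) : MvPowerSeries τ R))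
        ((PowerSeries.trunc k G : Polynomial R) : PowerSeries R) =
      PowerSeries.subst ((MvPowerSeries.truncTotal k a : MvPolynomial τ R) : MvPowerSeries τ R) ((PowerSeries.trunc k G : Polynomial R) : PowerSeries R)
      from rfl,
    PowerSeries.subst_coe hb]

end Algebra

omit [CompleteSpace K] in
/-- The coefficients of a power of an INTEGRAL polynomial (image of `ℤ[X₀,X₁]`) have norm `≤ 1`. [cite: SilvermanAEC2009, IV.2] -/
theorem norm_coeff_map_int_pow_le_one {τ : Type*} (T : MvPolynomial τ ℤ) (n : ℕ) (d : τ →₀ ℕ) :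
    ‖MvPolynomial.coeff d (MvPolynomial.map (Int.castRingHom K) T ^ n)‖ ≤ 1 := by
  rw [← MvPolynomial.coeff_coe, MvPolynomial.coe_pow]
  refine (norm_coeff_pow_le_mv (K := K) (f := ((MvPolynomial.map (Int.castRingHom K) T : MvPolynomial τ K) : MvPowerSeries τ K))
    zero_le_one (fun d' => ?_) n d).trans (by rw [one_pow])
  rw [MvPolynomial.coeff_coe, MvPolynomial.coeff_map, eq_intCast]
  exact IsUltrametricDist.norm_intCast_le_one K _

omit [CompleteSpace K] in
/-- **Coefficients of `G_{≤M}(T) − G_{≤M}(X₀) − G_{≤M}(X₁)` are `≤ M^k`** for an integral polynomial `T` and `‖cₙ‖ ≤ n^k`.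
[cite: Katz1981CrystallineDieudonne, §5.1] -/
theorem norm_coeff_aeval_trunc_sub_le (G : PowerSeries K) (k : ℕ) (hk : ∀ n, ‖PowerSeries.coeff n G‖ ≤ (n : ℝ) ^ k)
    (hG0 : PowerSeries.constantCoeff G = 0) (T : MvPolynomial (Fin 2) ℤ) (M : ℕ) (d : Fin 2 →₀ ℕ) :
    ‖MvPolynomial.coeff d (Polynomial.aeval (MvPolynomial.map (Int.castRingHom K) T) (PowerSeries.trunc (M + 1) G) -
        Polynomial.aeval (MvPolynomial.X 0 : MvPolynomial (Fin 2) K) (PowerSeries.trunc (M + 1) G) -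
        Polynomial.aeval (MvPolynomial.X 1 : MvPolynomial (Fin 2) K) (PowerSeries.trunc (M + 1) G))‖ ≤ (M : ℝ) ^ k := by
  -- each `aeval U (trunc (M+1) G) = Σ_{i ≤ M} cᵢ Uⁱ` with `‖coeff (Uⁱ)‖ ≤ 1`
  have hc : ∀ i ∈ range (M + 1), ‖PowerSeries.coeff i G‖ ≤ (M : ℝ) ^ k := by
    intro i hi
    rcases Nat.eq_zero_or_pos i with rfl | hi0
    · rw [PowerSeries.coeff_zero_eq_constantCoeff, hG0, norm_zero]; positivity
    · exact (hk i).trans (pow_le_pow_left₀ (Nat.cast_nonneg _) (by exact_mod_cast Nat.lt_succ_iff.mp (mem_range.mp hi)) k)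
  have hterm : ∀ (U : MvPolynomial (Fin 2) K), (∀ i e, ‖MvPolynomial.coeff e (U ^ i)‖ ≤ 1) →
      ‖MvPolynomial.coeff d (Polynomial.aeval U (PowerSeries.trunc (M + 1) G))‖ ≤ (M : ℝ) ^ k := by
    intro U hU
    rw [Polynomial.aeval_def, PowerSeries.eval₂_trunc_eq_sum_range, MvPolynomial.coeff_sum]
    refine IsUltrametricDist.norm_sum_le_of_forall_le_of_nonneg (by positivity) fun i hi => ?_
    rw [MvPolynomial.algebraMap_eq, MvPolynomial.coeff_C_mul, norm_mul]
    exact (mul_le_mul (hc i hi) (hU i d) (norm_nonneg _) (by positivity)).trans (by rw [mul_one])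
  have hX : ∀ (j : Fin 2) (i : ℕ) (e : Fin 2 →₀ ℕ), ‖MvPolynomial.coeff e ((MvPolynomial.X j : MvPolynomial (Fin 2) K) ^ i)‖ ≤ 1 := by
    intro j i e
    have h := norm_coeff_map_int_pow_le_one (K := K) (MvPolynomial.X j : MvPolynomial (Fin 2) ℤ) i e
    rwa [MvPolynomial.map_X] at h
  have hsub : ∀ a b : MvPolynomial (Fin 2) K, ‖MvPolynomial.coeff d (a - b)‖ ≤ max ‖MvPolynomial.coeff d a‖ ‖MvPolynomial.coeff d b‖ :=
    fun a b => by rw [MvPolynomial.coeff_sub, sub_eq_add_neg, ← norm_neg (MvPolynomial.coeff d b)]; exact IsUltrametricDist.norm_add_le_max _ _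
  refine (hsub _ _).trans (max_le ((hsub _ _).trans (max_le ?_ ?_)) ?_)
  · exact hterm _ (fun i e => norm_coeff_map_int_pow_le_one T i e)
  · exact hterm _ (hX 0)
  · exact hterm _ (hX 1)

/-! ## §3 The value cocycle bound -/

/-- ★★ **Values of a series of the second kind.** Let `G = Σ cₙXⁿ ∈ K⟦X⟧`, `c₀ = 0`, `‖cₙ‖ ≤ n^k`, and suppose the `F_W`-coboundary
`G(F_W(X,Y)) − G(X) − G(Y)` has all coefficients of norm `≤ C`. Then for all `s, t ∈ 𝔪_K`:
**`‖G(F_W(s,t)) − G(s) − G(t)‖ ≤ C`**, `G(x) = Σ' cₙxⁿ`. [cite: Katz1981CrystallineDieudonne, §5.1, Key Lemma 5.1.3] -/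
theorem norm_tsum_evF_sub_tsum_sub_tsum_le (W : WeierstrassCurve ℤ) (G : PowerSeries K) (hG0 : PowerSeries.constantCoeff G = 0) (k : ℕ)
    (hk : ∀ n, ‖PowerSeries.coeff n G‖ ≤ (n : ℝ) ^ k) {C : ℝ} (hC0 : 0 ≤ C)
    (hC : ∀ d : Fin 2 →₀ ℕ, ‖MvPowerSeries.coeff d (G.subst (W.map (Int.castRingHom K)).formalGroupLaw -
      G.subst (MvPowerSeries.X 0 : MvPowerSeries (Fin 2) K) - G.subst (MvPowerSeries.X 1 : MvPowerSeries (Fin 2) K))‖ ≤ C)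
    (s t : (ballNilIdeal K).toIdeal) :
    ‖∑' n : ℕ, PowerSeries.coeff n G * (((evF W s t : (ballNilIdeal K).toIdeal) : unitBall K) : K) ^ n -
        ∑' n : ℕ, PowerSeries.coeff n G * ((s : unitBall K) : K) ^ n -
        ∑' n : ℕ, PowerSeries.coeff n G * ((t : unitBall K) : K) ^ n‖ ≤ C := by
  -- notation
  set c : ℕ → K := fun n => PowerSeries.coeff n G with hc
  set σ : K := ((s : unitBall K) : K) with hσ
  set τ : K := ((t : unitBall K) : K) with hτ
  set g : K := (((evF W s t : (ballNilIdeal K).toIdeal) : unitBall K) : K) with hgdef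
  have hσ1 : ‖σ‖ < 1 := norm_lt_one_of_mem s
  have hτ1 : ‖τ‖ < 1 := norm_lt_one_of_mem t
  have hg1 : ‖g‖ < 1 := norm_lt_one_of_mem _
  set ρ : ℝ := max ‖σ‖ ‖τ‖ with hρ
  have hρ0 : 0 ≤ ρ := le_max_of_le_left (norm_nonneg _)
  have hρ1 : ρ < 1 := max_lt hσ1 hτ1
  -- partial sums `S M x = G_{≤M}(x)` and their limits
  set S : ℕ → K → K := fun M x => Polynomial.aeval x (PowerSeries.trunc (M + 1) G) with hS
  have hSsum : ∀ M x, S M x = ∑ n ∈ range (M + 1), c n * x ^ n := fun M x => by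
    rw [hS]
    simp only
    rw [Polynomial.aeval_def, PowerSeries.eval₂_trunc_eq_sum_range]
    exact Finset.sum_congr rfl fun n _ => rfl
  have hlim : ∀ {x : K}, ‖x‖ < 1 → Tendsto (fun M => S M x) atTop (𝓝 (∑' n : ℕ, c n * x ^ n)) := fun {x} hx => by
    have h := (tendsto_sum_range_coeff_mul_pow G k hk hx).comp (tendsto_add_atTop_nat 1)
    refine h.congr fun M => ?_
    rw [Function.comp_apply, hSsum]
  -- the truncated group law `T_M`, its value `G M`, and the distance to `g`
  set T : ℕ → MvPolynomial (Fin 2) ℤ := fun M => MvPowerSeries.truncTotal (M + 1) W.formalGroupLaw with hT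
  set GM : ℕ → K := fun M => MvPolynomial.aeval ![σ, τ] (T M) with hGM
  have hgG : ∀ M, ‖g - GM M‖ ≤ ρ ^ (M + 1) := fun M => norm_coe_evF_sub_aeval_truncTotal_le W s t M
  have hG1 : ∀ M, ‖GM M‖ ≤ 1 := fun M => by
    have h : GM M = g + (-(g - GM M)) := by ring
    rw [h]
    refine (IsUltrametricDist.norm_add_le_max _ _).trans (max_le hg1.le ?_)
    rw [norm_neg]; exact (hgG M).trans (pow_le_one₀ hρ0 hρ1.le)
  have hTK : ∀ M, MvPolynomial.aeval ![σ, τ] (MvPolynomial.map (Int.castRingHom K) (T M)) = GM M := fun M => by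
    rw [hGM, ← algebraMap_int_eq, MvPolynomial.aeval_map_algebraMap]
  -- the polynomial cocycle `Q_M = G_M(T_M) − G_M(X₀) − G_M(X₁)` and its value
  set Q : ℕ → MvPolynomial (Fin 2) K := fun M =>
    Polynomial.aeval (MvPolynomial.map (Int.castRingHom K) (T M)) (PowerSeries.trunc (M + 1) G) -
      Polynomial.aeval (MvPolynomial.X 0 : MvPolynomial (Fin 2) K) (PowerSeries.trunc (M + 1) G) -
      Polynomial.aeval (MvPolynomial.X 1 : MvPolynomial (Fin 2) K) (PowerSeries.trunc (M + 1) G) with hQ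
  have hQval : ∀ M, MvPolynomial.aeval ![σ, τ] (Q M) = S M (GM M) - S M σ - S M τ := fun M => by
    rw [hQ]
    simp only [map_sub]
    rw [← Polynomial.aeval_algHom_apply, ← Polynomial.aeval_algHom_apply, ← Polynomial.aeval_algHom_apply, hTK,
      MvPolynomial.aeval_X, MvPolynomial.aeval_X]
    rfl
  -- `Q_M` agrees with the coboundary below degree `M + 1`
  have hQtrunc : ∀ M, 1 ≤ M → MvPowerSeries.truncTotal (M + 1) ((Q M : MvPolynomial (Fin 2) K) : MvPowerSeries (Fin 2) K) =
      MvPowerSeries.truncTotal (M + 1) (G.subst (W.map (Int.castRingHom K)).formalGroupLaw -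
        G.subst (MvPowerSeries.X 0 : MvPowerSeries (Fin 2) K) - G.subst (MvPowerSeries.X 1 : MvPowerSeries (Fin 2) K)) := by
    intro M hM
    have hX : ∀ j : Fin 2, MvPowerSeries.truncTotal (M + 1) (MvPowerSeries.X j : MvPowerSeries (Fin 2) K) = MvPolynomial.X j := fun j => by
      rw [← MvPolynomial.coe_X, MvPowerSeries.truncTotal_coe_eq_self_iff _ (Nat.succ_ne_zero M), MvPolynomial.totalDegree_X]
      omega
    have hF : MvPowerSeries.truncTotal (M + 1) (W.map (Int.castRingHom K)).formalGroupLaw = MvPolynomial.map (Int.castRingHom K) (T M) := by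
      rw [← WeierstrassCurve.map_formalGroupLaw, map_truncTotal']
    rw [map_sub, map_sub, truncTotal_subst_eq_truncTotal_coe_aeval G _ (W.map (Int.castRingHom K)).constantCoeff_formalGroupLaw,
      truncTotal_subst_eq_truncTotal_coe_aeval G _ (MvPowerSeries.constantCoeff_X 0),
      truncTotal_subst_eq_truncTotal_coe_aeval G _ (MvPowerSeries.constantCoeff_X 1), hF, hX 0, hX 1, hQ]
    simp only [← map_sub (MvPowerSeries.truncTotal (M + 1) : MvPowerSeries (Fin 2) K →ₗ[K] MvPolynomial (Fin 2) K)]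
    congr 1
  -- the estimate `‖Q_M(σ, τ)‖ ≤ max C (M^k ρ^{M+1})`
  have hQest : ∀ M, 1 ≤ M → ‖MvPolynomial.aeval ![σ, τ] (Q M)‖ ≤ max C ((M : ℝ) ^ k * ρ ^ (M + 1)) := by
    intro M hM
    have hy : ∀ i, ‖(![σ, τ] : Fin 2 → K) i‖ ≤ ρ := fun i => by fin_cases i <;> simp [hρ]
    have hcoefQ : ∀ d, ‖MvPolynomial.coeff d (Q M)‖ ≤ (M : ℝ) ^ k := fun d => norm_coeff_aeval_trunc_sub_le G k hk hG0 (T M) M d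
    set Qlow : MvPolynomial (Fin 2) K := MvPowerSeries.truncTotal (M + 1) ((Q M : MvPolynomial (Fin 2) K) : MvPowerSeries (Fin 2) K) with hQlow
    have hsplit : Q M = Qlow + (Q M - Qlow) := by ring
    rw [hsplit, map_add]
    refine (IsUltrametricDist.norm_add_le_max _ _).trans (max_le_max ?_ ?_)
    · -- low part = truncated coboundary, coefficients `≤ C`
      have h := norm_aeval_le_mul_pow_of_coeff hρ0 hρ1.le hy (q := Qlow) hC0 (fun d => ?_) (N := 0) (fun d hd => absurd hd (Nat.not_lt_zero _))
      · rwa [pow_zero, mul_one] at h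
      · rw [hQlow, hQtrunc M hM, MvPowerSeries.coeff_truncTotal_eq_ite]
        split_ifs
        · exact hC d
        · rw [norm_zero]; exact hC0
    · -- high part: degrees `≥ M + 1`, coefficients `≤ M^k`
      refine norm_aeval_le_mul_pow_of_coeff hρ0 hρ1.le hy (by positivity) (fun d => ?_) (fun d hd => ?_)
      · rw [MvPolynomial.coeff_sub, hQlow, MvPowerSeries.coeff_truncTotal_eq_ite, MvPolynomial.coeff_coe]
        split_ifs
        · rw [sub_self, norm_zero]; positivity
        · rw [sub_zero]; exact hcoefQ d
      · rw [MvPolynomial.coeff_sub, hQlow, MvPowerSeries.coeff_truncTotal _ hd, MvPolynomial.coeff_coe, sub_self]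
  -- replacing `G_M(T_M(σ,τ))` by `G_M(g)`
  have hd : ∀ M, ‖S M g - S M (GM M)‖ ≤ (M : ℝ) ^ k * ρ ^ (M + 1) := fun M => by
    have h : S M g - S M (GM M) = ∑ n ∈ range (M + 1), c n * (g ^ n - GM M ^ n) := by
      rw [hSsum, hSsum, ← Finset.sum_sub_distrib]
      exact Finset.sum_congr rfl fun n _ => by rw [mul_sub]
    rw [h]
    refine IsUltrametricDist.norm_sum_le_of_forall_le_of_nonneg (by positivity) fun n hn => ?_
    rw [norm_mul]
    have hcn : ‖c n‖ ≤ (M : ℝ) ^ k := by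
      rcases Nat.eq_zero_or_pos n with rfl | hn0
      · rw [hc]; simp only; rw [PowerSeries.coeff_zero_eq_constantCoeff, hG0, norm_zero]; positivity
      · exact (hk n).trans (pow_le_pow_left₀ (Nat.cast_nonneg _) (by exact_mod_cast Nat.lt_succ_iff.mp (mem_range.mp hn)) k)
    exact mul_le_mul hcn ((norm_pow_sub_pow_le hg1.le (hG1 M) _).trans (hgG M)) (norm_nonneg _) (by positivity)
  -- total error
  have herr : ∀ᶠ M in atTop, ‖S M g - S M σ - S M τ‖ ≤ max C ((M : ℝ) ^ k * ρ ^ (M + 1)) := by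
    refine Filter.eventually_atTop.2 ⟨1, fun M hM => ?_⟩
    have h : S M g - S M σ - S M τ = (S M g - S M (GM M)) + (S M (GM M) - S M σ - S M τ) := by ring
    rw [h, ← hQval]
    exact (IsUltrametricDist.norm_add_le_max _ _).trans (max_le (le_max_of_le_right (hd M)) (hQest M hM))
  have hbound : Tendsto (fun M : ℕ => max C ((M : ℝ) ^ k * ρ ^ (M + 1))) atTop (𝓝 C) := by
    have h := (tendsto_pow_const_mul_const_pow_of_abs_lt_one k (r := ρ) (by rwa [abs_of_nonneg hρ0])).mul_const ρ
    rw [zero_mul] at h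
    have h' : Tendsto (fun M : ℕ => (M : ℝ) ^ k * ρ ^ (M + 1)) atTop (𝓝 0) := h.congr fun M => by ring
    have := (tendsto_const_nhds (x := C)).max h'
    rwa [max_eq_left hC0] at this
  have hlim3 : Tendsto (fun M => ‖S M g - S M σ - S M τ‖) atTop
      (𝓝 ‖∑' n : ℕ, c n * g ^ n - ∑' n : ℕ, c n * σ ^ n - ∑' n : ℕ, c n * τ ^ n‖) :=
    (((hlim hg1).sub (hlim hσ1)).sub (hlim hτ1)).norm
  exact le_of_tendsto_of_tendsto hlim3 hbound herr

end Literature.NumberTheory.EllipticCurves
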